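import Mathlib
import Summits.MatrixMultiplication.MatrixMultiplication.Theses.FidelityWitnesses
import Literature.Computability.AlgebraicComplexity.MatMulRankLowerBoundsProofs
import Literature.Computability.AlgebraicComplexity.AlderStrassen
import Literature.Computability.AlgebraicComplexity.AsymptoticRankZariskiClosedProofs
import Summits.MatrixMultiplication.MatrixMultiplication.Theorems.FidelityWitnessesSevenEighthsLawDistance
import Summits.MatrixMultiplication.MatrixMultiplication.Theorems.FidelityWitnessesSixEighthsAtFiveEffectiveKoszul
import Summits.MatrixMultiplication.MatrixMultiplication.Theorems.FidelityWitnessesSixEighthsAtFiveEffectiveBound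
import Summits.MatrixMultiplication.MatrixMultiplication.Theorems.FidelityWitnessesSixEighthsAtFiveEffectiveHalf

/-!
# `FidelityWitnesses.SixEighthsAtFive` (stmt-MatrixMultiplication-14040) — effective bound IV: `M(2,5) ≤ 22/3`

Support file for the item `SixEighthsAtFive` (`M(2,5) ≤ 6`).  Part III (`dist² ≥ 1/2`, `M(2,5) ≤ 15/2`) is the Eckart–Young
limit of ONE Koszul flattening `K_Φ`.  Here FOUR flattenings are used jointly: three symmetries `g₁, g₂, g₃` of `⟨2,2,2⟩`
(sign/swaps of the `2 × 2` indices) carry the kernel direction `e₀₁ − e₁₀` of the Pauli map `Φ` to `e₀₁ + e₁₀`, `e₀₀ − e₁₁`,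
`e₀₀ + e₁₁` — an orthonormal frame of `ℂ^{2×2}`.  Applying part III's step `2 ≤ Σ_{r,q}|K_Φ(T − S′)_{rq}|²` to the four
rank-`≤ 5` tensors `S, g₁S, g₂S, g₃S` and adding, the exact Hilbert–Schmidt identity and the four-frame identity
`Σ_k ‖Φ(g_k y)‖² = 6‖y‖²` give `8 ≤ 12 Σ|T − S|²`: **`Σ|⟨2,2,2⟩ − S|² ≥ 2/3` and `‖Σ S·⟨2,2,2⟩‖² ≤ (22/3) Σ‖S‖²`**
for `R(S) ≤ 5` (`2/3` is the optimum of this averaging; the item claims distance `2`, constant `6`).  No new definitions.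
-/

set_option linter.dupNamespace false

namespace Summit.MatrixMultiplication.MatrixMultiplication.Theorems

open scoped BigOperators ComplexConjugate
open Matrix
open Literature.Computability.AlgebraicComplexity

/-- The index type `Fin 2 × Fin 2` of `2 × 2` matrices. -/
local notation "P2" => Fin 2 × Fin 2

set_option quotPrecheck false in
/-- The `3 × 4` Pauli coordinate matrix (rows `I`, `σₓ`, `σ_z`): `Φ X = (x₀₀+x₁₁, x₀₁+x₁₀, x₀₀−x₁₁)`. -/
local notation "pauliMat" => (Matrix.of fun (j : Fin (2 * 1 + 1)) (a : Fin 2 × Fin 2) =>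
    if j = 0 then (if a.1 = a.2 then (1 : ℂ) else 0)
    else if j = 1 then (if a.1 = a.2 then (0 : ℂ) else 1)
    else (if a.1 = a.2 then (if a.1 = 0 then (1 : ℂ) else -1) else 0))

set_option quotPrecheck false in
/-- The Pauli projection `ℂ^{2×2} → ℂ³` as a linear map. -/
local notation "ΦP" => Matrix.mulVecLin pauliMat

set_option quotPrecheck false in
/-- The `p = 1` Koszul flattening after the Pauli projection (a `12 × 12` matrix, linear in the tensor). -/
local notation "KP" => koszulFlattening 1 ΦP

set_option quotPrecheck false in
/-- `⟨2,2,2⟩` over `ℂ`. -/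
local notation "TT" => (matMulTensor ℂ 2 2 2)

/-- The column blocks `{0}, {1}, {2}` (`PSub 3 1`). -/
local notation "S0" => (⟨{0}, by decide⟩ : PSub (2 * 1 + 1) 1)
local notation "S1" => (⟨{1}, by decide⟩ : PSub (2 * 1 + 1) 1)
local notation "S2" => (⟨{2}, by decide⟩ : PSub (2 * 1 + 1) 1)
/-- The row blocks `{0,1}, {0,2}, {1,2}` (`PSub 3 2`). -/
local notation "T01" => (⟨{0, 1}, by decide⟩ : PSub (2 * 1 + 1) (1 + 1))
local notation "T02" => (⟨{0, 2}, by decide⟩ : PSub (2 * 1 + 1) (1 + 1))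
local notation "T12" => (⟨{1, 2}, by decide⟩ : PSub (2 * 1 + 1) (1 + 1))

/-! ## The exact Hilbert–Schmidt identity and the `2 ≤ HS` step of part III -/

/-- `Σ_{r,q} |K_Φ(t)_{rq}|² = 2 Σ_{c,b,j} |Φ(t(·,b,c))_j|²` (every Pauli coordinate of every fibre occurs in exactly two
entries of the flattening). [folklore] -/
theorem effective_hs_eq (t : P2 → P2 → P2 → ℂ) :
    (∑ r, ∑ q, ‖KP t r q‖ ^ 2) = 2 * ∑ c, ∑ b, ∑ j, ‖(ΦP) (fun a => t a b c) j‖ ^ 2 := by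
  rw [Fintype.sum_prod_type, effective_sum_PSub_two]
  simp only [effective_hs_row01, effective_hs_row02, effective_hs_row12]
  rw [← Finset.sum_add_distrib, ← Finset.sum_add_distrib, Finset.mul_sum]
  refine Finset.sum_congr rfl fun c _ => ?_
  rw [← Finset.sum_add_distrib, ← Finset.sum_add_distrib, Finset.mul_sum]
  refine Finset.sum_congr rfl fun b _ => ?_
  rw [Fin.sum_univ_three]
  simp only [show ((0 : Fin 3)) = (0 : Fin (2 * 1 + 1)) from rfl,
    show ((1 : Fin 3)) = (1 : Fin (2 * 1 + 1)) from rfl,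
    show ((2 : Fin 3)) = (2 : Fin (2 * 1 + 1)) from rfl]
  ring

/-- **`2 ≤ Σ_{r,q} |K_Φ(⟨2,2,2⟩ − S')_{rq}|²` for every `S'` of rank `≤ 5`** (part III's chain: two orthogonal kernel
vectors `x ⊥ y` of `K_Φ(S')`, `‖x‖² ≤ ‖K(T)x‖² = ‖K(T−S')x‖²`, Bessel over the rows). [folklore] -/
theorem effective_two_le_hs (S' : P2 → P2 → P2 → ℂ) (hS' : tensorRank S' ≤ 5) :
    (2 : ℝ) ≤ ∑ r, ∑ q, ‖KP (fun a b c => TT a b c - S' a b c) r q‖ ^ 2 := by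
  obtain ⟨x, y, hx0, hy0, hKx, hKy, hxy⟩ := effective_exists_kernel_pair S' hS'
  set D : P2 → P2 → P2 → ℂ := fun a b c => TT a b c - S' a b c with hD
  have hTD : TT = D + S' := by
    funext a b c
    simp [hD]
  have hKxD : KP TT *ᵥ x = KP D *ᵥ x := by
    rw [hTD, koszulFlattening_add, Matrix.add_mulVec, hKx, add_zero]
  have hKyD : KP TT *ᵥ y = KP D *ᵥ y := by
    rw [hTD, koszulFlattening_add, Matrix.add_mulVec, hKy, add_zero]
  set nx : ℝ := ∑ q, ‖x q‖ ^ 2 with hnx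
  set ny : ℝ := ∑ q, ‖y q‖ ^ 2 with hny
  have hpos : ∀ z : PSub (2 * 1 + 1) 1 × P2 → ℂ, z ≠ 0 → 0 < ∑ q, ‖z q‖ ^ 2 := by
    intro z hz
    obtain ⟨q, hq⟩ : ∃ q, z q ≠ 0 := Function.ne_iff.mp hz
    have hq' : 0 < ‖z q‖ ^ 2 := by positivity
    exact lt_of_lt_of_le hq'
      (Finset.single_le_sum (f := fun q => ‖z q‖ ^ 2) (fun q _ => by positivity) (Finset.mem_univ q))
  have hnx0 : 0 < nx := hpos x hx0
  have hny0 : 0 < ny := hpos y hy0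
  have hlx : nx ≤ ∑ r, ‖(KP D *ᵥ x) r‖ ^ 2 := by
    have := effective_lower_bound x
    rwa [hKxD] at this
  have hly : ny ≤ ∑ r, ‖(KP D *ᵥ y) r‖ ^ 2 := by
    have := effective_lower_bound y
    rwa [hKyD] at this
  have hpair := effective_pair_rows D x y hxy
  have h1 : ny * nx + nx * ny ≤ (∑ r, ∑ q, ‖KP D r q‖ ^ 2) * nx * ny := by
    calc ny * nx + nx * ny ≤ ny * (∑ r, ‖(KP D *ᵥ x) r‖ ^ 2) + nx * ∑ r, ‖(KP D *ᵥ y) r‖ ^ 2 :=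
          add_le_add (mul_le_mul_of_nonneg_left hlx hny0.le) (mul_le_mul_of_nonneg_left hly hnx0.le)
      _ ≤ (∑ r, ∑ q, ‖KP D r q‖ ^ 2) * nx * ny := hpair
  have h3 : 2 * (nx * ny) ≤ (∑ r, ∑ q, ‖KP D r q‖ ^ 2) * (nx * ny) := by nlinarith [h1]
  exact le_of_mul_le_mul_right h3 (by positivity)

/-! ## Three symmetries of `⟨2,2,2⟩` carrying the kernel direction of `Φ` to an orthonormal frame -/

set_option quotPrecheck false in
/-- The sign `σ i = (−1)^i` on `Fin 2`. -/
local notation "σ" => (fun i : Fin 2 => if i = 0 then (1 : ℂ) else -1)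

set_option quotPrecheck false in
/-- The swap of `Fin 2`. -/
local notation "ρ" => (fun i : Fin 2 => if i = 0 then (1 : Fin 2) else 0)

/-- Diagonal scalings of the three slots are restrictions. [folklore] -/
theorem effective_restrictsTo_diag {ι κ μ : Type*} [Fintype ι] [Fintype κ] [Fintype μ] [DecidableEq ι]
    [DecidableEq κ] [DecidableEq μ] (t : ι → κ → μ → ℂ) (α : ι → ℂ) (β : κ → ℂ) (γ : μ → ℂ) :
    TensorRestrictsTo t (fun a b c => α a * β b * γ c * t a b c) := by
  refine ⟨fun a' a => if a' = a then α a else 0, fun b' b => if b' = b then β b else 0,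
    fun c' c => if c' = c then γ c else 0, fun a' b' c' => ?_⟩
  rw [Finset.sum_eq_single a' (fun a _ ha => by simp [Ne.symm ha]) (by simp),
    Finset.sum_eq_single b' (fun b _ hb => by simp [Ne.symm hb]) (by simp),
    Finset.sum_eq_single c' (fun c _ hc => by simp [Ne.symm hc]) (by simp)]
  simp

/-- Symmetry 1 (signs `(−1)^{a.1} (−1)^{b.1}`) does not increase the rank. [folklore] -/
theorem effective_rank_sym1 (S : P2 → P2 → P2 → ℂ) :
    tensorRank (fun a b c : P2 => σ a.1 * σ b.1 * S a b c) ≤ tensorRank S := by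
  have h := (effective_restrictsTo_diag S (fun a => σ a.1) (fun b => σ b.1) (fun _ => 1)).tensorRank_le
  simpa using h

/-- Symmetry 2 (swapping the second coordinate of `a` and of `c`) does not increase the rank. [folklore] -/
theorem effective_rank_sym2 (S : P2 → P2 → P2 → ℂ) :
    tensorRank (fun a b c : P2 => S (a.1, ρ a.2) b (c.1, ρ c.2)) ≤ tensorRank S :=
  (tensorRestrictsTo_precomp S (fun a : P2 => (a.1, ρ a.2)) id (fun c : P2 => (c.1, ρ c.2))).tensorRank_le

/-- Symmetry 3 (= 1 ∘ 2) does not increase the rank. [folklore] -/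
theorem effective_rank_sym3 (S : P2 → P2 → P2 → ℂ) :
    tensorRank (fun a b c : P2 => σ a.1 * σ b.1 * S (a.1, ρ a.2) b (c.1, ρ c.2)) ≤ tensorRank S :=
  (effective_rank_sym1 _).trans (effective_rank_sym2 S)

/-- `⟨2,2,2⟩` is invariant under symmetry 1. [folklore] -/
theorem effective_TT_sym1 : (fun a b c : P2 => σ a.1 * σ b.1 * TT a b c) = TT := by
  funext a b c
  obtain ⟨a1, a2⟩ := a; obtain ⟨b1, b2⟩ := b; obtain ⟨c1, c2⟩ := c
  fin_cases a1 <;> fin_cases b1 <;> simp [matMulTensor]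

/-- `⟨2,2,2⟩` is invariant under symmetry 2. [folklore] -/
theorem effective_TT_sym2 : (fun a b c : P2 => TT (a.1, ρ a.2) b (c.1, ρ c.2)) = TT := by
  funext a b c
  obtain ⟨a1, a2⟩ := a; obtain ⟨b1, b2⟩ := b; obtain ⟨c1, c2⟩ := c
  fin_cases a2 <;> fin_cases c2 <;> simp [matMulTensor]

/-- `⟨2,2,2⟩` is invariant under symmetry 3. [folklore] -/
theorem effective_TT_sym3 : (fun a b c : P2 => σ a.1 * σ b.1 * TT (a.1, ρ a.2) b (c.1, ρ c.2)) = TT := by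
  have h2 := effective_TT_sym2
  have h1 := effective_TT_sym1
  funext a b c
  have e2 := congrFun (congrFun (congrFun h2 a) b) c
  have e1 := congrFun (congrFun (congrFun h1 a) b) c
  simp only at e1 e2 ⊢
  rw [e2, e1]

/-! ## The four-frame identity `Σ_k ‖Φ(g_k y)‖² = 6‖y‖²` -/

/-- The Pauli map on a sign-twisted fibre: `‖Φ(σ∘pr₁ · y)‖² = |y₀₀−y₁₁|² + |y₀₁−y₁₀|² + |y₀₀+y₁₁|²` etc.;
combined with the swap twist, the four squared norms add up to `6‖y‖²` (two parallelogram laws). [folklore] -/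
theorem effective_four_frames (y : P2 → ℂ) :
    (∑ j, ‖(ΦP) y j‖ ^ 2) + (∑ j, ‖(ΦP) (fun a => σ a.1 * y a) j‖ ^ 2) +
      (∑ j, ‖(ΦP) (fun a => y (a.1, ρ a.2)) j‖ ^ 2) +
      (∑ j, ‖(ΦP) (fun a => σ a.1 * y (a.1, ρ a.2)) j‖ ^ 2) = 6 * ∑ a, ‖y a‖ ^ 2 := by
  have hpol : ∀ p q : ℂ, ‖p + q‖ ^ 2 + ‖p - q‖ ^ 2 = 2 * ‖p‖ ^ 2 + 2 * ‖q‖ ^ 2 := fun p q => by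
    simp only [Complex.sq_norm, Complex.normSq_add, Complex.normSq_sub]; ring
  rw [Fin.sum_univ_three, Fin.sum_univ_three, Fin.sum_univ_three, Fin.sum_univ_three]
  simp only [Fintype.sum_prod_type, Fin.sum_univ_two, Fin.isValue]
  rw [show ((0 : Fin 3)) = (0 : Fin (2 * 1 + 1)) from rfl,
    show ((1 : Fin 3)) = (1 : Fin (2 * 1 + 1)) from rfl,
    show ((2 : Fin 3)) = (2 : Fin (2 * 1 + 1)) from rfl]
  simp only [effective_pauli_apply_zero, effective_pauli_apply_one, effective_pauli_apply_two, Fin.isValue,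
    if_true, one_ne_zero, if_false, one_mul, neg_one_mul]
  have k1 := hpol (y (0, 0)) (y (1, 1))
  have k2 := hpol (y (0, 1)) (y (1, 0))
  have e1 : ‖y (0, 0) + -y (1, 1)‖ = ‖y (0, 0) - y (1, 1)‖ := by rw [← sub_eq_add_neg]
  have e2 : ‖y (0, 1) + -y (1, 0)‖ = ‖y (0, 1) - y (1, 0)‖ := by rw [← sub_eq_add_neg]
  have e3 : ‖y (0, 0) - -y (1, 1)‖ = ‖y (0, 0) + y (1, 1)‖ := by rw [sub_neg_eq_add]
  have e4 : ‖y (0, 1) - -y (1, 0)‖ = ‖y (0, 1) + y (1, 0)‖ := by rw [sub_neg_eq_add]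
  have e5 : ‖y (0, 1) + y (1, 0)‖ = ‖y (0, 1) + y (1, 0)‖ := rfl
  have c1 : ‖y (1, 0) + y (0, 1)‖ = ‖y (0, 1) + y (1, 0)‖ := by rw [add_comm]
  have c2 : ‖y (0, 1) - y (1, 0)‖ ^ 2 = ‖y (1, 0) - y (0, 1)‖ ^ 2 := by rw [← norm_neg, neg_sub]
  simp only [e1, e2, e3, e4]
  nlinarith [k1, k2, c1, c2, sq_nonneg ‖y (0,0) + y (1,1)‖, norm_nonneg (y (0,1) + -y (1,0))]

/-! ## Assembly -/

/-- Reindexing the last slot along the swap of its second coordinate. -/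
theorem effective_sum_swap2 (f : P2 → ℝ) : (∑ c : P2, f (c.1, ρ c.2)) = ∑ c, f c := by
  simp only [Fintype.sum_prod_type, Fin.sum_univ_two, Fin.isValue, if_true, one_ne_zero, if_false]
  ring

/-- `‖σ i‖ = 1`. -/
theorem effective_norm_sigma (i : Fin 2) : ‖(σ) i‖ = 1 := by
  fin_cases i <;> simp

/-- **Every tensor of rank `≤ 5` lies at squared Frobenius distance `≥ 2/3` from `⟨2,2,2⟩`** (four Koszul flattenings:
`Σ_k 2 ≤ Σ_k ‖K_Φ(T − g_kS)‖²_HS = 2 Σ_{b,c} Σ_k ‖Φ(g_k D(·,b,c))‖² = 12 ‖D‖²`).  Parts II/III had `1/4`, `1/2`; the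
item's sharp value is `2`. [folklore] -/
theorem sixEighthsAtFive_dist_sq_ge_two_thirds (S : P2 → P2 → P2 → ℂ) (hS : tensorRank S ≤ 5) :
    (2 / 3 : ℝ) ≤ ∑ a, ∑ b, ∑ c, ‖matMulTensor ℂ 2 2 2 a b c - S a b c‖ ^ 2 := by
  set D : P2 → P2 → P2 → ℂ := fun a b c => TT a b c - S a b c with hD
  -- the four rank-`≤ 5` tensors
  have h0 := effective_two_le_hs S hS
  have h1 := effective_two_le_hs _ ((effective_rank_sym1 S).trans hS)
  have h2 := effective_two_le_hs _ ((effective_rank_sym2 S).trans hS)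
  have h3 := effective_two_le_hs _ ((effective_rank_sym3 S).trans hS)
  rw [effective_hs_eq] at h0 h1 h2 h3
  -- pointwise invariance of `T`
  have t1 : ∀ a b c : P2, TT a b c = σ a.1 * σ b.1 * TT a b c := fun a b c =>
    (congrFun (congrFun (congrFun effective_TT_sym1 a) b) c).symm
  have t2 : ∀ a b c : P2, TT a b c = TT (a.1, ρ a.2) b (c.1, ρ c.2) := fun a b c =>
    (congrFun (congrFun (congrFun effective_TT_sym2 a) b) c).symm
  -- the four fibres in terms of `D`
  have nsq : ∀ (b : P2) (y : P2 → ℂ) (j), ‖(ΦP) (fun a => σ b.1 * y a) j‖ ^ 2 = ‖(ΦP) y j‖ ^ 2 := by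
    intro b y j
    have : (fun a => σ b.1 * y a) = σ b.1 • y := by funext a; simp [Pi.smul_apply]
    rw [this, map_smul, Pi.smul_apply, smul_eq_mul, norm_mul, effective_norm_sigma, one_mul]
  have F1 : ∀ b c : P2, (∑ j, ‖(ΦP) (fun a => TT a b c - σ a.1 * σ b.1 * S a b c) j‖ ^ 2) =
      ∑ j, ‖(ΦP) (fun a => σ a.1 * D a b c) j‖ ^ 2 := by
    intro b c
    have e : (fun a => TT a b c - σ a.1 * σ b.1 * S a b c) = (fun a => σ b.1 * (σ a.1 * D a b c)) := by
      funext a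
      rw [hD]
      conv_lhs => rw [t1 a b c]
      ring
    rw [e]
    exact Finset.sum_congr rfl fun j _ => nsq b _ j
  have F2 : ∀ b c : P2, (fun a => TT a b c - S (a.1, ρ a.2) b (c.1, ρ c.2)) =
      (fun a => D (a.1, ρ a.2) b (c.1, ρ c.2)) := by
    intro b c
    funext a
    rw [hD]
    conv_lhs => rw [t2 a b c]
  have F3 : ∀ b c : P2, (∑ j, ‖(ΦP) (fun a => TT a b c - σ a.1 * σ b.1 * S (a.1, ρ a.2) b (c.1, ρ c.2)) j‖ ^ 2) =
      ∑ j, ‖(ΦP) (fun a => σ a.1 * D (a.1, ρ a.2) b (c.1, ρ c.2)) j‖ ^ 2 := by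
    intro b c
    have e : (fun a => TT a b c - σ a.1 * σ b.1 * S (a.1, ρ a.2) b (c.1, ρ c.2)) =
        (fun a => σ b.1 * (σ a.1 * D (a.1, ρ a.2) b (c.1, ρ c.2))) := by
      funext a
      rw [hD]
      conv_lhs => rw [t1 a b c, t2 a b c]
      ring
    rw [e]
    exact Finset.sum_congr rfl fun j _ => nsq b _ j
  simp only [F1] at h1
  simp only [F2] at h2
  simp only [F3] at h3
  -- reindex `c` in `h2`, `h3`
  rw [effective_sum_swap2 (fun c => ∑ b, ∑ j, ‖(ΦP) (fun a => D (a.1, ρ a.2) b c) j‖ ^ 2)] at h2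
  rw [effective_sum_swap2 (fun c => ∑ b, ∑ j, ‖(ΦP) (fun a => σ a.1 * D (a.1, ρ a.2) b c) j‖ ^ 2)] at h3
  -- the four-frame identity, fibrewise
  have key : (∑ c, ∑ b, ∑ j, ‖(ΦP) (fun a => D a b c) j‖ ^ 2) +
      (∑ c, ∑ b, ∑ j, ‖(ΦP) (fun a => σ a.1 * D a b c) j‖ ^ 2) +
      (∑ c, ∑ b, ∑ j, ‖(ΦP) (fun a => D (a.1, ρ a.2) b c) j‖ ^ 2) +
      (∑ c, ∑ b, ∑ j, ‖(ΦP) (fun a => σ a.1 * D (a.1, ρ a.2) b c) j‖ ^ 2) =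
      6 * ∑ c, ∑ b, ∑ a, ‖D a b c‖ ^ 2 := by
    rw [← Finset.sum_add_distrib, ← Finset.sum_add_distrib, ← Finset.sum_add_distrib, Finset.mul_sum]
    refine Finset.sum_congr rfl fun c _ => ?_
    rw [← Finset.sum_add_distrib, ← Finset.sum_add_distrib, ← Finset.sum_add_distrib, Finset.mul_sum]
    refine Finset.sum_congr rfl fun b _ => ?_
    have h4 := effective_four_frames (fun a => D a b c)
    beta_reduce at h4
    exact h4
  have hT : (∑ a, ∑ b, ∑ c, ‖D a b c‖ ^ 2) = ∑ c, ∑ b, ∑ a, ‖D a b c‖ ^ 2 := by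
    calc (∑ a, ∑ b, ∑ c, ‖D a b c‖ ^ 2) = ∑ a, ∑ c, ∑ b, ‖D a b c‖ ^ 2 :=
          Finset.sum_congr rfl fun a _ => Finset.sum_comm
      _ = ∑ c, ∑ a, ∑ b, ‖D a b c‖ ^ 2 := Finset.sum_comm
      _ = ∑ c, ∑ b, ∑ a, ‖D a b c‖ ^ 2 := Finset.sum_congr rfl fun c _ => Finset.sum_comm
  have h0' : (2 : ℝ) ≤ 2 * ∑ c, ∑ b, ∑ j, ‖(ΦP) (fun a => D a b c) j‖ ^ 2 := h0
  have total : (8 : ℝ) ≤ 2 * (6 * ∑ c, ∑ b, ∑ a, ‖D a b c‖ ^ 2) := by rw [← key]; linarith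
  rw [← hT, hD] at total
  linarith

/-- **The third effective bound at `(2,5)`: `‖Σ S·⟨2,2,2⟩‖² ≤ (22/3) Σ‖S‖²` for `R(S) ≤ 5`** (`M(2,5) ≤ 7.34`;
parts II/III: `7.75`, `7.5`; the item claims `6`): the distance bound polarised on the cone of rank-`≤ 5` tensors. -/
theorem sixEighthsAtFive_effective_frames (S : P2 → P2 → P2 → ℂ) (hS : tensorRank S ≤ 5) :
    ‖∑ a, ∑ b, ∑ c, S a b c * matMulTensor ℂ 2 2 2 a b c‖ ^ 2 ≤
      (22 / 3) * ∑ a, ∑ b, ∑ c, ‖S a b c‖ ^ 2 := by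
  set N : ℝ := ∑ a, ∑ b, ∑ c, ‖S a b c‖ ^ 2 with hN
  set B : ℂ := ∑ a, ∑ b, ∑ c, S a b c * matMulTensor ℂ 2 2 2 a b c with hBdef
  have hN0 : 0 ≤ N := by positivity
  rcases hN0.lt_or_eq with hNpos | hN00
  · set lam : ℂ := conj B / (N : ℂ) with hlam
    have key := sixEighthsAtFive_dist_sq_ge_two_thirds (lam • S) ((tensorRank_smul_le lam S).trans hS)
    rw [SevenEighthsLaw.sevenEighthsLaw_dist_sq_expand] at key
    have hNl : (∑ a, ∑ b, ∑ c, ‖(lam • S) a b c‖ ^ 2) = ‖lam‖ ^ 2 * N := by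
      simp only [Pi.smul_apply, smul_eq_mul, norm_mul, mul_pow, hN, Finset.mul_sum]
    have hBl : (∑ a, ∑ b, ∑ c, (lam • S) a b c * matMulTensor ℂ 2 2 2 a b c) = lam * B := by
      simp only [Pi.smul_apply, smul_eq_mul, hBdef, Finset.mul_sum, mul_assoc]
    rw [hNl, hBl] at key
    have h1 : ‖lam‖ ^ 2 * N = ‖B‖ ^ 2 / N := by
      rw [hlam, norm_div, Complex.norm_conj, Complex.norm_real, Real.norm_of_nonneg hNpos.le]
      field_simp
    have h2 : (lam * B).re = ‖B‖ ^ 2 / N := by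
      have : lam * B = ((‖B‖ ^ 2 / N : ℝ) : ℂ) := by
        rw [hlam, div_mul_eq_mul_div, Complex.conj_mul']
        push_cast
        ring
      rw [this, Complex.ofReal_re]
    rw [h1, h2] at key
    have h3 : ‖B‖ ^ 2 / N ≤ 22 / 3 := by linarith
    rw [div_le_iff₀ hNpos] at h3
    linarith
  · have hS0 : ∀ a b c, S a b c = 0 := by
      intro a b c
      have hsum : (∑ a, ∑ b, ∑ c, ‖S a b c‖ ^ 2) = 0 := hN00.symm
      have ha := (Finset.sum_eq_zero_iff_of_nonneg fun a _ => by positivity).1 hsum a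
        (Finset.mem_univ a)
      have hb := (Finset.sum_eq_zero_iff_of_nonneg fun b _ => by positivity).1 ha b
        (Finset.mem_univ b)
      have hc := (Finset.sum_eq_zero_iff_of_nonneg fun c _ => by positivity).1 hb c
        (Finset.mem_univ c)
      simpa using hc
    have hB0 : B = 0 := by
      rw [hBdef]
      exact Finset.sum_eq_zero fun a _ => Finset.sum_eq_zero fun b _ =>
        Finset.sum_eq_zero fun c _ => by rw [hS0 a b c, zero_mul]
    rw [hB0, ← hN00]
    simp

end Summit.MatrixMultiplication.MatrixMultiplication.Theorems
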